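import Summits.QuantumFields.YangMills.Theorems.BalabanUVNodesN19SmoothLinkFirstOrder

/-!
# YM-DAG node N19 (= NE7 proper) — THE SMOOTHED-LINK FIRST-ORDER LAW WITH A LOCALISED REMAINDER
# (module 151's parametric law verbatim, the `C^{1,1}` hypothesis replaced by `|u − a| ≤ dπ∕2^J ⇒ |g(u) − g(a) − g₁(a)(u − a)| ≤ R`)

Cell `pub-ymgap`, HUMAN RULING D-0062 (Track A) ∕ D-0149, R141 (C) seat `pub-ymgap-dag-n19-e` (s3 = ALTERNATIVE CURRENCY), generation g35,
module 6 (lineage module 190).  Route `Summits/QuantumFields/YangMills/Theses/BalabanUVNodes.lean`, cluster item K3⁸ «SpineGivenEndpointR13SepCoPHV»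
(stmt-QuantumFields-27366); filed `--supports` that item `--as helper` (it proves no registered stub).  COUNT-NEUTRAL: [folklore]∕[bookkeeping] over the
lineage BY NAME — module 151 `…N19SmoothLinkFirstOrder` (`exists_ladder_pairs_near_cexp_additiveJackson_uniform`, `abs_cos_sub_le_of_pair`,
`abs_sin_sub_le_of_pair`), PART 2 `…N19SingleModeL1Norm` (`exists_additiveJackson`); no laws, no scheme object, no Theses import; NOT a discharge claim.

WHY.  Module 151 (`exists_mvPolynomial_near_trigLink_firstOrder`) asks for the GLOBAL `C^{1,1}` bound `|g(u) − g(a) − g₁(a)(u − a)| ≤ B₂(u − a)²` but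
USES it only at `(u, a) = (S, A_J)` with `|S − A_J| ≤ dπ∕2^J`.  For links whose derivative has a MODULUS OF CONTINUITY (not Lipschitz) the natural
remainder is `≤ ω(g′, |u − a|)·|u − a|` — not quadratic; the law only needs it at the one scale `dπ∕2^J`.  ★★★
`exists_mvPolynomial_near_trigLink_firstOrder_local`: the same polynomial, degree bound and proof, with the hypothesis
`∀ u a, |u − a| ≤ dπ∕2^J → |g(u) − g(a) − g₁(a)(u − a)| ≤ R` and the error `R + B₁dπ∕N + 2(J+1)e^{−h}W(1 + Ω(dπ∕2^J + dπ∕N))` (module 151 is the case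
`R = B₂(dπ∕2^J)²`).  The sequels (lineage 191–193) run module 176's budget for links with a modulus of continuity of `h′`: the logarithm of the general
row multiplies ONLY the oscillation of `h′` at the scale `d·log t∕t`.

HONEST FRAMING (binding).  Elementary and [folklore]; the proof is module 151's VERBATIM up to the one remainder line (a copy, declared as such); NO
consumer in the DAG today; nothing of Bałaban's instantiated; NE7 NOT PRINTED, NOT proved; N19 NOT discharged; count-neutral.  One finite `T⁴` programme
at fixed `ε`; nothing continuum ∕ `ℝ⁴` ∕ OS ∕ mass-gap ∕ Clay.  0 `def` ∕ 0 `sorry`.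
-/

noncomputable section

open Finset Complex
open scoped Real

namespace Summit.QuantumFields.YangMills.Theorems.BalabanUVNodesN19SmoothLinkFirstOrderLocal

open Summit.QuantumFields.YangMills.Theorems.BalabanUVNodesN19SmoothLinkFirstOrder
  (exists_ladder_pairs_near_cexp_additiveJackson_uniform abs_cos_sub_le_of_pair abs_sin_sub_le_of_pair)
open Summit.QuantumFields.YangMills.Theorems.BalabanUVNodesN19SingleModeL1Norm (exists_additiveJackson)

variable {ι : Type*} [Fintype ι]

/-! ## §1 ★★★ The first-order law with a localised remainder [folklore] -/

/-- ★★★ **THE SMOOTHED-LINK FIRST-ORDER LAW — LOCALISED REMAINDER.**  Let `σ` be a finite index set,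
`g(s) = c + Σ_{p∈σ}(α_p cos(ω_p s) + β_p sin(ω_p s))` a trigonometric link with frequencies `0 ≤ ω_p ≤ Ω`, formal derivative
`g₁(s) = Σ_p ω_p(β_p cos(ω_p s) − α_p sin(ω_p s))`, mass `Σ_p(|α_p| + |β_p|) ≤ W`, `|g₁| ≤ B₁`; let `J : ℕ`, `h ≥ 1`, `N ≥ 2^J` with `(J+1)e^{−h} ≤ ½`,
and assume the LOCALISED remainder bound `|g(u) − g(a) − g₁(a)(u − a)| ≤ R` whenever `|u − a| ≤ dπ∕2^J` (`d = |ι|`).  Then there is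
`P : MvPolynomial ι ℝ` of total degree `≤ 2e²·Ωd·(½ + π + 3πJ) + 2h(2^{J+1} − 1) + 2N` with, on `[−1,1]^ι`,
`|g(Σ_i|x_i|) − P(x)| ≤ R + B₁·dπ∕N + 2(J+1)e^{−h}·W·(1 + Ω(dπ∕2^J + dπ∕N))` (module 151's polynomial and proof; module 151 = the case
`R = B₂(dπ∕2^J)²`). [folklore] -/
theorem exists_mvPolynomial_near_trigLink_firstOrder_local {σ : Type*} (P₀ : Finset σ) (c : ℝ) (α β ω : σ → ℝ)
    {g g₁ : ℝ → ℝ} {Ω W B₁ R : ℝ}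
    (hg : ∀ s, g s = c + ∑ p ∈ P₀, (α p * Real.cos (ω p * s) + β p * Real.sin (ω p * s)))
    (hg₁ : ∀ s, g₁ s = ∑ p ∈ P₀, ω p * (β p * Real.cos (ω p * s) - α p * Real.sin (ω p * s)))
    (hΩ : 0 ≤ Ω) (hω0 : ∀ p, 0 ≤ ω p) (hωΩ : ∀ p ∈ P₀, ω p ≤ Ω) (hW : ∑ p ∈ P₀, (|α p| + |β p|) ≤ W) (hB₁ : ∀ a, |g₁ a| ≤ B₁)
    (J h N : ℕ) (hh : 1 ≤ h) (hJh : ((J : ℝ) + 1) * Real.exp (-(h : ℝ)) ≤ 1 / 2) (hN : 2 ^ J ≤ N)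
    (hC11 : ∀ u a, |u - a| ≤ Fintype.card ι * π / 2 ^ J → |g u - g a - g₁ a * (u - a)| ≤ R) :
    ∃ P : MvPolynomial ι ℝ,
      (P.totalDegree : ℝ) ≤ 2 * Real.exp 2 * Ω * Fintype.card ι * (1 / 2 + π + 3 * π * J) + 2 * h * (2 ^ (J + 1) - 1) + 2 * N ∧
      ∀ x : ι → ℝ, (∀ i, x i ∈ Set.Icc (-1 : ℝ) 1) →
        |g (∑ i, |x i|) - MvPolynomial.eval x P| ≤
          R + B₁ * (Fintype.card ι * π / N) +
            2 * ((J : ℝ) + 1) * Real.exp (-(h : ℝ)) * W *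
              (1 + Ω * (Fintype.card ι * π / 2 ^ J + Fintype.card ι * π / N)) := by
  classical
  set d : ℝ := (Fintype.card ι : ℝ) with hd
  have hd0 : 0 ≤ d := Nat.cast_nonneg _
  have hNpos : 0 < N := lt_of_lt_of_le (pow_pos two_pos J) hN
  have hNr : (0 : ℝ) < N := by exact_mod_cast hNpos
  have h2J : (0 : ℝ) < 2 ^ J := by positivity
  set ε : ℝ := 2 * ((J : ℝ) + 1) * Real.exp (-(h : ℝ)) with hε
  have hε0 : 0 ≤ ε := by positivity
  -- sign facts from the hypotheses
  have hW0 : 0 ≤ W := le_trans (Finset.sum_nonneg fun p _ => by positivity) hW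
  have hB₁0 : 0 ≤ B₁ := (abs_nonneg _).trans (hB₁ 0)
  -- the ladder (one `A_J`), its pairs, and the fine Jackson approximant `A_N`
  obtain ⟨A, hAdeg, hAerr, hlad⟩ := exists_ladder_pairs_near_cexp_additiveJackson_uniform (ι := ι) J h hh hJh
  choose Cr Ci hCr hCi happ using fun p : σ => hlad (ω p) (hω0 p)
  obtain ⟨AN, hANdeg, hANerr⟩ := exists_additiveJackson (ι := ι) (M := N) hNpos
  -- degrees
  set X : ℝ := 2 * Real.exp 2 * Ω * d * (1 / 2 + π + 3 * π * J) + 2 * h * (2 ^ (J + 1) - 1) with hX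
  set D : ℕ := ⌊X⌋₊ with hD
  have hXp : ∀ p ∈ P₀, 2 * Real.exp 2 * ω p * d * (1 / 2 + π + 3 * π * J) + 2 * h * (2 ^ (J + 1) - 1) ≤ X := by
    intro p hp
    have h1 : 2 * Real.exp 2 * ω p * d * (1 / 2 + π + 3 * π * J) ≤ 2 * Real.exp 2 * Ω * d * (1 / 2 + π + 3 * π * J) := by
      have hωp := hωΩ p hp
      have hc : (0 : ℝ) ≤ 2 * Real.exp 2 := by positivity
      have hJ0 : (0 : ℝ) ≤ 1 / 2 + π + 3 * π * J := by positivity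
      have : 2 * Real.exp 2 * ω p ≤ 2 * Real.exp 2 * Ω := mul_le_mul_of_nonneg_left hωp hc
      exact mul_le_mul_of_nonneg_right (mul_le_mul_of_nonneg_right this hd0) hJ0
    rw [hX]; linarith only [h1]
  have hdegCr : ∀ p ∈ P₀, (Cr p).totalDegree ≤ D := fun p hp => Nat.le_floor ((hCr p).trans (hXp p hp))
  have hdegCi : ∀ p ∈ P₀, (Ci p).totalDegree ≤ D := fun p hp => Nat.le_floor ((hCi p).trans (hXp p hp))
  have hdegCmul : ∀ (r : ℝ) (Q : MvPolynomial ι ℝ), Q.totalDegree ≤ D → (MvPolynomial.C r * Q).totalDegree ≤ D := by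
    intro r Q hQ
    calc (MvPolynomial.C r * Q).totalDegree ≤ (MvPolynomial.C r : MvPolynomial ι ℝ).totalDegree + Q.totalDegree :=
          MvPolynomial.totalDegree_mul _ _
      _ ≤ 0 + D := by rw [MvPolynomial.totalDegree_C]; exact add_le_add le_rfl hQ
      _ = D := zero_add _
  -- the polynomial
  set G₀ : MvPolynomial ι ℝ := MvPolynomial.C c + ∑ p ∈ P₀, (MvPolynomial.C (α p) * Cr p + MvPolynomial.C (β p) * Ci p) with hG₀
  set G₁ : MvPolynomial ι ℝ := ∑ p ∈ P₀, MvPolynomial.C (ω p) * (MvPolynomial.C (β p) * Cr p - MvPolynomial.C (α p) * Ci p) with hG₁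
  have hG₀deg : G₀.totalDegree ≤ D := by
    refine (MvPolynomial.totalDegree_add _ _).trans (max_le ?_ ?_)
    · rw [MvPolynomial.totalDegree_C]; exact Nat.zero_le _
    · refine MvPolynomial.totalDegree_finsetSum_le fun p hp => ?_
      exact (MvPolynomial.totalDegree_add _ _).trans (max_le (hdegCmul _ _ (hdegCr p hp)) (hdegCmul _ _ (hdegCi p hp)))
  have hG₁deg : G₁.totalDegree ≤ D := by
    refine MvPolynomial.totalDegree_finsetSum_le fun p hp => hdegCmul _ _ ?_
    exact (MvPolynomial.totalDegree_sub _ _).trans (max_le (hdegCmul _ _ (hdegCr p hp)) (hdegCmul _ _ (hdegCi p hp)))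
  have hΔdeg : (AN - A).totalDegree ≤ 2 * N := by
    refine (MvPolynomial.totalDegree_sub _ _).trans (max_le hANdeg (hAdeg.trans ?_))
    exact Nat.mul_le_mul_left 2 hN
  have hX0 : 0 ≤ X := by
    rw [hX]
    have : (1 : ℝ) ≤ 2 ^ (J + 1) := one_le_pow₀ (by norm_num)
    have hh0 : (0 : ℝ) ≤ h := Nat.cast_nonneg _
    have h2 : (0 : ℝ) ≤ 2 * h * (2 ^ (J + 1) - 1) := by nlinarith
    positivity
  refine ⟨G₀ + G₁ * (AN - A), ?_, fun x hx => ?_⟩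
  · have hnat : (G₀ + G₁ * (AN - A)).totalDegree ≤ D + 2 * N := by
      refine (MvPolynomial.totalDegree_add _ _).trans (max_le (hG₀deg.trans (Nat.le_add_right _ _)) ?_)
      exact (MvPolynomial.totalDegree_mul _ _).trans (add_le_add hG₁deg hΔdeg)
    have h1 : ((D + 2 * N : ℕ) : ℝ) ≤ X + 2 * N := by push_cast; linarith only [Nat.floor_le hX0]
    exact ((Nat.cast_le.2 hnat).trans h1).trans (by rw [hX])
  -- the error at `x`
  set s : ℝ := ∑ i, |x i| with hs
  set a : ℝ := MvPolynomial.eval x A with ha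
  set aN : ℝ := MvPolynomial.eval x AN with haN
  have hsa : |s - a| ≤ d * π / 2 ^ J := hAerr x hx
  have hsaN : |s - aN| ≤ d * π / N := (hANerr x hx).trans_eq (by rw [hd]; ring)
  have haNa : |aN - a| ≤ d * π / 2 ^ J + d * π / N := by
    calc |aN - a| = |(s - a) - (s - aN)| := by ring_nf
      _ ≤ |s - a| + |s - aN| := abs_sub _ _
      _ ≤ d * π / 2 ^ J + d * π / N := add_le_add hsa hsaN
  -- evaluations of `G₀`, `G₁`
  have hevG₀ : MvPolynomial.eval x G₀ = c + ∑ p ∈ P₀, (α p * MvPolynomial.eval x (Cr p) + β p * MvPolynomial.eval x (Ci p)) := by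
    rw [hG₀, map_add, MvPolynomial.eval_C, map_sum]
    refine congrArg _ (Finset.sum_congr rfl fun p _ => ?_)
    rw [map_add, map_mul, map_mul, MvPolynomial.eval_C, MvPolynomial.eval_C]
  have hevG₁ : MvPolynomial.eval x G₁ =
      ∑ p ∈ P₀, ω p * (β p * MvPolynomial.eval x (Cr p) - α p * MvPolynomial.eval x (Ci p)) := by
    rw [hG₁, map_sum]
    refine Finset.sum_congr rfl fun p _ => ?_
    rw [map_mul, MvPolynomial.eval_C, map_sub, map_mul, map_mul, MvPolynomial.eval_C, MvPolynomial.eval_C]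
  -- the ladder errors at `a`
  have hcos : ∀ p, |Real.cos (ω p * a) - MvPolynomial.eval x (Cr p)| ≤ ε := fun p =>
    abs_cos_sub_le_of_pair (happ p x hx)
  have hsin : ∀ p, |Real.sin (ω p * a) - MvPolynomial.eval x (Ci p)| ≤ ε := fun p =>
    abs_sin_sub_le_of_pair (happ p x hx)
  have hE₀ : |g a - MvPolynomial.eval x G₀| ≤ ε * W := by
    rw [hg a, hevG₀, add_sub_add_left_eq_sub, ← Finset.sum_sub_distrib]
    calc |∑ p ∈ P₀, (α p * Real.cos (ω p * a) + β p * Real.sin (ω p * a) -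
            (α p * MvPolynomial.eval x (Cr p) + β p * MvPolynomial.eval x (Ci p)))|
        ≤ ∑ p ∈ P₀, |α p * Real.cos (ω p * a) + β p * Real.sin (ω p * a) -
            (α p * MvPolynomial.eval x (Cr p) + β p * MvPolynomial.eval x (Ci p))| := abs_sum_le_sum_abs _ _
      _ ≤ ∑ p ∈ P₀, (|α p| + |β p|) * ε := by
          refine Finset.sum_le_sum fun p _ => ?_
          have e : α p * Real.cos (ω p * a) + β p * Real.sin (ω p * a) -
              (α p * MvPolynomial.eval x (Cr p) + β p * MvPolynomial.eval x (Ci p)) =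
              α p * (Real.cos (ω p * a) - MvPolynomial.eval x (Cr p)) + β p * (Real.sin (ω p * a) - MvPolynomial.eval x (Ci p)) := by
            ring
          rw [e]
          calc |α p * (Real.cos (ω p * a) - MvPolynomial.eval x (Cr p)) + β p * (Real.sin (ω p * a) - MvPolynomial.eval x (Ci p))|
              ≤ |α p * (Real.cos (ω p * a) - MvPolynomial.eval x (Cr p))| + |β p * (Real.sin (ω p * a) - MvPolynomial.eval x (Ci p))| :=
                abs_add_le _ _
            _ ≤ |α p| * ε + |β p| * ε := by
                rw [abs_mul, abs_mul]
                exact add_le_add (mul_le_mul_of_nonneg_left (hcos p) (abs_nonneg _))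
                  (mul_le_mul_of_nonneg_left (hsin p) (abs_nonneg _))
            _ = (|α p| + |β p|) * ε := by ring
      _ = (∑ p ∈ P₀, (|α p| + |β p|)) * ε := by rw [Finset.sum_mul]
      _ ≤ W * ε := mul_le_mul_of_nonneg_right hW hε0
      _ = ε * W := mul_comm _ _
  have hE₁ : |g₁ a - MvPolynomial.eval x G₁| ≤ ε * W * Ω := by
    rw [hg₁ a, hevG₁, ← Finset.sum_sub_distrib]
    calc |∑ p ∈ P₀, (ω p * (β p * Real.cos (ω p * a) - α p * Real.sin (ω p * a)) -
            ω p * (β p * MvPolynomial.eval x (Cr p) - α p * MvPolynomial.eval x (Ci p)))|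
        ≤ ∑ p ∈ P₀, |ω p * (β p * Real.cos (ω p * a) - α p * Real.sin (ω p * a)) -
            ω p * (β p * MvPolynomial.eval x (Cr p) - α p * MvPolynomial.eval x (Ci p))| := abs_sum_le_sum_abs _ _
      _ ≤ ∑ p ∈ P₀, (|α p| + |β p|) * ε * Ω := by
          refine Finset.sum_le_sum fun p hp => ?_
          have e : ω p * (β p * Real.cos (ω p * a) - α p * Real.sin (ω p * a)) -
              ω p * (β p * MvPolynomial.eval x (Cr p) - α p * MvPolynomial.eval x (Ci p)) =
              ω p * (β p * (Real.cos (ω p * a) - MvPolynomial.eval x (Cr p)) - α p * (Real.sin (ω p * a) - MvPolynomial.eval x (Ci p))) := by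
            ring
          rw [e, abs_mul, abs_of_nonneg (hω0 p)]
          have h1 : |β p * (Real.cos (ω p * a) - MvPolynomial.eval x (Cr p)) - α p * (Real.sin (ω p * a) - MvPolynomial.eval x (Ci p))| ≤
              (|α p| + |β p|) * ε := by
            calc |β p * (Real.cos (ω p * a) - MvPolynomial.eval x (Cr p)) - α p * (Real.sin (ω p * a) - MvPolynomial.eval x (Ci p))|
                ≤ |β p * (Real.cos (ω p * a) - MvPolynomial.eval x (Cr p))| + |α p * (Real.sin (ω p * a) - MvPolynomial.eval x (Ci p))| :=
                  abs_sub _ _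
              _ ≤ |β p| * ε + |α p| * ε := by
                  rw [abs_mul, abs_mul]
                  exact add_le_add (mul_le_mul_of_nonneg_left (hcos p) (abs_nonneg _))
                    (mul_le_mul_of_nonneg_left (hsin p) (abs_nonneg _))
              _ = (|α p| + |β p|) * ε := by ring
          calc ω p * |β p * (Real.cos (ω p * a) - MvPolynomial.eval x (Cr p)) - α p * (Real.sin (ω p * a) - MvPolynomial.eval x (Ci p))|
              ≤ Ω * ((|α p| + |β p|) * ε) := mul_le_mul (hωΩ p hp) h1 (abs_nonneg _) hΩ
            _ = (|α p| + |β p|) * ε * Ω := by ring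
      _ = (∑ p ∈ P₀, (|α p| + |β p|)) * ε * Ω := by rw [Finset.sum_mul, Finset.sum_mul]
      _ ≤ W * ε * Ω := mul_le_mul_of_nonneg_right (mul_le_mul_of_nonneg_right hW hε0) hΩ
      _ = ε * W * Ω := by ring
  -- assemble
  have hev : MvPolynomial.eval x (G₀ + G₁ * (AN - A)) = MvPolynomial.eval x G₀ + MvPolynomial.eval x G₁ * (aN - a) := by
    rw [map_add, map_mul, map_sub]
  rw [hev]
  have hsplit : g s - (MvPolynomial.eval x G₀ + MvPolynomial.eval x G₁ * (aN - a)) =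
      (g s - g a - g₁ a * (s - a)) + g₁ a * (s - aN) + (g a - MvPolynomial.eval x G₀) +
        (g₁ a - MvPolynomial.eval x G₁) * (aN - a) := by ring
  rw [hsplit]
  have hT1 : |g s - g a - g₁ a * (s - a)| ≤ R := hC11 s a hsa
  have hT2 : |g₁ a * (s - aN)| ≤ B₁ * (d * π / N) := by
    rw [abs_mul]; exact mul_le_mul (hB₁ a) hsaN (abs_nonneg _) hB₁0
  have hT4 : |(g₁ a - MvPolynomial.eval x G₁) * (aN - a)| ≤ ε * W * Ω * (d * π / 2 ^ J + d * π / N) := by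
    rw [abs_mul]
    exact mul_le_mul hE₁ haNa (abs_nonneg _) ((abs_nonneg _).trans hE₁)
  calc |(g s - g a - g₁ a * (s - a)) + g₁ a * (s - aN) + (g a - MvPolynomial.eval x G₀) +
        (g₁ a - MvPolynomial.eval x G₁) * (aN - a)|
      ≤ |g s - g a - g₁ a * (s - a)| + |g₁ a * (s - aN)| + |g a - MvPolynomial.eval x G₀| +
        |(g₁ a - MvPolynomial.eval x G₁) * (aN - a)| := by
        refine (abs_add_le _ _).trans (add_le_add ((abs_add_le _ _).trans (add_le_add (abs_add_le _ _) le_rfl)) le_rfl)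
    _ ≤ R + B₁ * (d * π / N) + ε * W + ε * W * Ω * (d * π / 2 ^ J + d * π / N) :=
        add_le_add (add_le_add (add_le_add hT1 hT2) hE₀) hT4
    _ = R + B₁ * (d * π / N) + ε * W * (1 + Ω * (d * π / 2 ^ J + d * π / N)) := by ring

end Summit.QuantumFields.YangMills.Theorems.BalabanUVNodesN19SmoothLinkFirstOrderLocal

end
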